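import Literature.NumberTheory.EllipticCurves.BSDQuadraticDescentCasselsHeightProofs
import Literature.NumberTheory.EllipticCurves.BSDShaProofs
import Mathlib.GroupTheory.FiniteAbelian.Basic
import HarnessLib

/-!
# Cassels' isogeny invariance of the BSD quotient: the Cassels–Tate step via `ℚ/ℤ`-duality

Fourth sibling *proofs* file (theorems only, no new named fact) of
`Literature.NumberTheory.EllipticCurves.BSDQuadraticDescent` for the named fact
`WeierstrassCurve.bsdRHS_eq_of_isIsogenous` (Cassels 1965; Milne, *Arithmetic Duality Theorems*,
Thm. I.7.3). The siblings `BSDQuadraticDescentCasselsProofs`/`…CasselsHeightProofs` reduced the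
equality of the Birch–Swinnerton-Dyer quotients of a `ℚ`-isogenous pair `φ : E → E'`, `ψ = φ̂`,
to two inputs: (Ш) the order identity `#Ш(E) · #ker Ш(ψ) = #Ш(E') · #ker Ш(φ)` and Milne's
formula (7.3.1). In Milne's proof (*ADT*, p. 98) the identity (Ш) is obtained from the
Cassels–Tate pairings: "(6.13a) shows that the two pairings … are nondegenerate, … therefore
`[Coker Ш(f)] = [Ker Ш(fᵗ)]`", the maps `Ш(f)` and `Ш(fᵗ)` being adjoint for the pairings
(*ADT*, Remark I.6.10(a): `⟨f(a), b⟩ = ⟨a, fᵗ(b)⟩`, "the local pairings are functorial"). This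
file proves that step — it is finite abelian group duality with values in `ℚ/ℤ` — and records
the resulting reductions, in which (Ш) is replaced by the existence of alternating pairings on
`Ш(E)`, `Ш(E')` with values in `ℚ/ℤ = AddCircle (1 : ℚ)`, left kernels inside the divisible
subgroups (the shape of the tree's `WeierstrassCurve.exists_casselsTate_pairing`, Silverman
X.4.14 / *ADT* I.6.13(a)) and adjoint for `(Ш(φ), Ш(φ̂))` (*ADT* I.6.10(a)):

* `Literature.NumberTheory.EllipticCurves.finite_addMonoidHom_addCircle`,
  `natCard_zmod_addMonoidHom_addCircle_le`, `natCard_addMonoidHom_addCircle_le`: for a finite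
  abelian group `X`, `Hom(X, ℚ/ℤ)` is finite of order `≤ #X` (structure theorem + `#(ℚ/ℤ)[m] ≤ m`).
* `Literature.NumberTheory.EllipticCurves.natCard_mul_natCard_eq_of_forall_mem_iff`: for a
  left-nondegenerate `ℚ/ℤ`-valued pairing `B` on a finite abelian group `T` and a subgroup `H`,
  the right annihilator `H^⊥` satisfies `#H · #H^⊥ = #T`.
* `Literature.NumberTheory.EllipticCurves.index_range_eq_natCard_ker_of_adjoint`: for adjoint maps
  `f : T → T'`, `g : T' → T` (`B' (f a) b' = B a (g b')`) between finite abelian groups with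
  nondegenerate `ℚ/ℤ`-valued pairings, `#coker f = #ker g` (Milne, *ADT*, p. 98).
* `WeierstrassCurve.Isogeny.card_sha_mul_card_ker_eq_of_pairing`: hence (Ш) for a pair of
  isogenies `φ : E → E'`, `ψ : E' → E` with `Ш(E)`, `Ш(E')` finite, from nondegenerate pairings
  making `Ш(φ)`, `Ш(ψ)` adjoint.
* `WeierstrassCurve.Isogeny.card_sha_mul_regulator_mul_eq_of_casselsTate_of_keyIdentity` (number
  field) and `WeierstrassCurve.bsdRHS_eq_of_casselsTate_of_keyIdentity` (over `ℚ`): Milne's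
  Theorem I.7.3 for elliptic curves reduced to the Cassels–Tate pairings of `E`, `E'` with their
  kernel clause and isogeny-adjointness (*ADT* I.6.13(a), I.6.10(a)) and formula (7.3.1).
* `WeierstrassCurve.bsdRHS_eq_of_isIsogenous_of_casselsTate_of_keyIdentity`: the assembly — the
  named fact `WeierstrassCurve.bsdRHS_eq_of_isIsogenous` itself follows from those two inputs
  quantified over all `ℚ`-isogenies (choice of `φ`, of the dual `φ̂` with `φ̂ ∘ φ = [deg φ]`, of the
  maps on rational points, and Lemma I.7.1(b) for the finiteness of `Ш(E'/ℚ)`).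

What still separates these from `bsdRHS_eq_of_isIsogenous_holds`: the *construction* of the
Cassels–Tate pairing with I.6.13(a) and I.6.10(a) (Tate local duality, global class field theory),
and (7.3.1) (Poitou–Tate I.4.10, Euler characteristics I.5.2(a), local volumes) — not in Mathlib
or the tree.

## References

* [MilneADT2006] J. S. Milne, *Arithmetic Duality Theorems*, 2nd ed. (2006), Ch. I: Prop. 6.9 and
  Remark 6.10(a) (p. 79), Thm. 6.13(a) (p. 82), Thm. 7.3 and its proof (pp. 97–100).
* [Cassels1965ArithmeticVIII] J. W. S. Cassels, *Arithmetic on curves of genus 1. VIII*,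
  J. reine angew. Math. 217 (1965), 180–199.
* [SilvermanAEC2009] J. H. Silverman, *The Arithmetic of Elliptic Curves*, 2nd ed., Thm. X.4.14.

## Design

Theorems only (D-0026: no new named fact). `ℚ/ℤ` is `AddCircle (1 : ℚ)` as in `BSDSha.lean`;
the only input about it is Mathlib's `AddCircle.card_torsion_le_of_isSMulRegular`
(`#{x | m • x = 0} ≤ m`). `noncomputable section`, `open scoped Classical` as in the topic.
-/

noncomputable section

open scoped Classical

universe u

/-! ## Duality of finite abelian groups with values in `ℚ/ℤ` -/

namespace Literature.NumberTheory.EllipticCurves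

section Duality

/-- For a finite abelian group `X`, `Hom(X, ℚ/ℤ)` is finite: a homomorphism is determined by its
values, which are killed by `#X`, and `(ℚ/ℤ)[#X]` is finite. [folklore] -/
theorem finite_addMonoidHom_addCircle (X : Type*) [AddCommGroup X] [Finite X] :
    Finite (X →+ AddCircle (1 : ℚ)) := by
  have hN : 0 < Nat.card X := Nat.card_pos
  have hfin : {c : AddCircle (1 : ℚ) | Nat.card X • c = 0}.Finite := AddCircle.finite_torsion 1 hN
  haveI := hfin.to_subtype
  refine Finite.of_injective
    (fun (φ : X →+ AddCircle (1 : ℚ)) (x : X) ↦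
      (⟨φ x, by rw [Set.mem_setOf_eq, ← map_nsmul, card_nsmul_eq_zero', map_zero]⟩ :
        {c : AddCircle (1 : ℚ) | Nat.card X • c = 0})) fun φ ψ h ↦ ?_
  ext x
  exact congrArg Subtype.val (congrFun h x)

/-- `#Hom(ℤ/m, ℚ/ℤ) ≤ m` for `0 < m`: evaluation at `1` embeds `Hom(ℤ/m, ℚ/ℤ)` into the
`m`-torsion of `ℚ/ℤ`, which has at most `m` elements
(Mathlib `AddCircle.card_torsion_le_of_isSMulRegular`). [folklore] -/
theorem natCard_zmod_addMonoidHom_addCircle_le (m : ℕ) (hm : 0 < m) :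
    Nat.card (ZMod m →+ AddCircle (1 : ℚ)) ≤ m := by
  haveI : NeZero m := ⟨hm.ne'⟩
  have hreg : IsSMulRegular ℚ m := by
    intro a b hab
    simp only [nsmul_eq_mul] at hab
    exact mul_left_cancel₀ (by exact_mod_cast hm.ne') hab
  have hT : {x : AddCircle (1 : ℚ) | m • x = 0}.encard ≤ m :=
    AddCircle.card_torsion_le_of_isSMulRegular 1 m hm.ne' hreg
  have hfin : {x : AddCircle (1 : ℚ) | m • x = 0}.Finite := AddCircle.finite_torsion 1 hm
  haveI := hfin.to_subtype
  have hcard : Nat.card {x : AddCircle (1 : ℚ) | m • x = 0} ≤ m := by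
    rw [Nat.card_coe_set_eq, ← Nat.cast_le (α := ℕ∞), hfin.cast_ncard_eq]
    exact hT
  refine le_trans (Nat.card_le_card_of_injective
    (fun φ : ZMod m →+ AddCircle (1 : ℚ) ↦
      (⟨φ 1, by rw [Set.mem_setOf_eq, ← map_nsmul, nsmul_one, ZMod.natCast_self, map_zero]⟩ :
        {x : AddCircle (1 : ℚ) | m • x = 0})) fun φ ψ h ↦ ?_) hcard
  have h1 : φ 1 = ψ 1 := congrArg Subtype.val h
  ext x
  rw [← ZMod.natCast_zmod_val x, ← nsmul_one, map_nsmul, map_nsmul, h1]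

/-- **`#Hom(X, ℚ/ℤ) ≤ #X` for a finite abelian group `X`** (in fact equality holds: Pontryagin
duality for finite groups). Proof: `X ≅ ⊕ ℤ/nᵢ` (structure theorem), `Hom(⊕ ℤ/nᵢ, ℚ/ℤ) ≅
∏ Hom(ℤ/nᵢ, ℚ/ℤ)` and `#Hom(ℤ/nᵢ, ℚ/ℤ) ≤ nᵢ`. [folklore] -/
theorem natCard_addMonoidHom_addCircle_le (X : Type*) [AddCommGroup X] [Finite X] :
    Nat.card (X →+ AddCircle (1 : ℚ)) ≤ Nat.card X := by
  obtain ⟨ι, _, n, hn, ⟨e⟩⟩ := AddCommGroup.equiv_directSum_zmod_of_finite' X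
  let e' : X ≃+ (Π i, ZMod (n i)) := e.trans (DirectSum.addEquivProd _)
  have hX : Nat.card X = ∏ i, n i := by
    rw [Nat.card_congr e'.toEquiv, Nat.card_pi]
    simp only [Nat.card_zmod]
  have hH : Nat.card (X →+ AddCircle (1 : ℚ)) =
      ∏ i, Nat.card (ZMod (n i) →+ AddCircle (1 : ℚ)) := by
    rw [Nat.card_congr (e'.addMonoidHomCongrLeftEquiv.trans
      (Pi.addMonoidHomAddEquiv (fun i ↦ ZMod (n i)) (AddCircle (1 : ℚ))).toEquiv), Nat.card_pi]
  rw [hX, hH]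
  exact Finset.prod_le_prod (fun _ _ ↦ Nat.zero_le _)
    fun i _ ↦ natCard_zmod_addMonoidHom_addCircle_le (n i) (lt_trans Nat.zero_lt_one (hn i))

variable {T T' : Type*} [AddCommGroup T] [AddCommGroup T']

/-- **Annihilators under a nondegenerate `ℚ/ℤ`-valued pairing.** Let `B : T × T → ℚ/ℤ` be a
bi-additive pairing on a finite abelian group with trivial left kernel, `H ≤ T` a subgroup and
`A = H^⊥ = {y | ∀ h ∈ H, B h y = 0}` its right annihilator. Then `#H · #A = #T`: the maps
`T/A ↪ Hom(H, ℚ/ℤ)` and `H ↪ Hom(T/A, ℚ/ℤ)` (the latter injective by nondegeneracy) give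
`[T : A] ≤ #H ≤ [T : A]` by `#Hom(X, ℚ/ℤ) ≤ #X`. (Milne, *ADT*, proof of I.7.3, p. 98: "the two
pairings are nondegenerate, therefore `[Coker Ш(f)] = [Ker Ш(fᵗ)]`".) [folklore] -/
theorem natCard_mul_natCard_eq_of_forall_mem_iff [Finite T] (B : T →+ T →+ AddCircle (1 : ℚ))
    (hB : ∀ x, (∀ y, B x y = 0) → x = 0) (H A : AddSubgroup T)
    (hA : ∀ y, y ∈ A ↔ ∀ h ∈ H, B h y = 0) : Nat.card H * Nat.card A = Nat.card T := by
  -- (i) `Φ : T → Hom(H, ℚ/ℤ)`, `y ↦ (h ↦ B h y)`, has kernel `A`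
  let Φ : T →+ (H →+ AddCircle (1 : ℚ)) := (B.comp H.subtype).flip
  have hΦ : Φ.ker = A := by
    ext y
    rw [AddMonoidHom.mem_ker, hA]
    constructor
    · intro h x hx
      have := DFunLike.congr_fun h ⟨x, hx⟩
      simpa [Φ] using this
    · intro h
      ext ⟨x, hx⟩
      simpa [Φ] using h x hx
  haveI := finite_addMonoidHom_addCircle H
  have h1 : Nat.card (T ⧸ A) ≤ Nat.card H := by
    rw [← hΦ]
    exact (Nat.card_le_card_of_injective _ (QuotientAddGroup.kerLift_injective Φ)).trans
      (natCard_addMonoidHom_addCircle_le H)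
  -- (ii) `Ψ : H → Hom(T/A, ℚ/ℤ)`, `h ↦ (ȳ ↦ B h y)`, is injective by nondegeneracy
  have hle : ∀ h : H, A ≤ (B h).ker := fun h y hy ↦
    (AddMonoidHom.mem_ker).mpr (((hA y).mp hy) h h.2)
  haveI := finite_addMonoidHom_addCircle (T ⧸ A)
  have h2 : Nat.card H ≤ Nat.card (T ⧸ A) := by
    refine (Nat.card_le_card_of_injective
      (fun h : H ↦ QuotientAddGroup.lift A (B h) (hle h)) fun h h' hhh ↦ ?_).trans
      (natCard_addMonoidHom_addCircle_le (T ⧸ A))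
    have hB' : ∀ y, B (h : T) y = B (h' : T) y := fun y ↦ by
      simpa only [QuotientAddGroup.lift_mk] using DFunLike.congr_fun hhh (y : T ⧸ A)
    rw [Subtype.ext_iff, ← sub_eq_zero]
    exact hB _ fun y ↦ by rw [map_sub, AddMonoidHom.sub_apply, hB' y, sub_self]
  -- (iii) `#T = [T : A] · #A`
  rw [le_antisymm h2 h1]
  exact (AddSubgroup.card_eq_card_quotient_mul_card_addSubgroup A).symm

/-- **`#coker f = #ker g` for adjoint maps** (Milne, *ADT*, proof of Thm. I.7.3, p. 98, the step
"`[Coker Ш(f)] = [Ker Ш(fᵗ)]`", abstract form). Let `T`, `T'` be finite abelian groups with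
bi-additive pairings `B`, `B'` into `ℚ/ℤ`, `B` with trivial right kernel and `B'` with trivial
left kernel, and let `f : T → T'`, `g : T' → T` be adjoint: `B' (f a) b' = B a (g b')`. Then
`ker g` is the right annihilator of `f(T)` under `B'`, so `[T' : f(T)] = #ker g` by
`natCard_mul_natCard_eq_of_forall_mem_iff`. [cite: MilneADT2006, Ch. I, proof of Thm. 7.3, p. 98] -/
theorem index_range_eq_natCard_ker_of_adjoint [Finite T'] (B : T →+ T →+ AddCircle (1 : ℚ))
    (B' : T' →+ T' →+ AddCircle (1 : ℚ)) (hB : ∀ y, (∀ x, B x y = 0) → y = 0)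
    (hB' : ∀ x, (∀ y, B' x y = 0) → x = 0) (f : T →+ T') (g : T' →+ T)
    (hadj : ∀ a b', B' (f a) b' = B a (g b')) : f.range.index = Nat.card g.ker := by
  have hker : ∀ y, y ∈ g.ker ↔ ∀ h ∈ f.range, B' h y = 0 := fun y ↦ by
    rw [AddMonoidHom.mem_ker]
    constructor
    · rintro hy _ ⟨a, rfl⟩
      rw [hadj, hy, map_zero]
    · intro h
      exact hB _ fun a ↦ by rw [← hadj]; exact h _ ⟨a, rfl⟩
  have hcard := natCard_mul_natCard_eq_of_forall_mem_iff B' hB' f.range g.ker hker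
  rw [← f.range.card_mul_index] at hcard
  exact (Nat.eq_of_mul_eq_mul_left Nat.card_pos hcard).symm

end Duality

end Literature.NumberTheory.EllipticCurves

/-! ## The Cassels–Tate step (Ш) of Milne's proof of Theorem I.7.3 -/

namespace WeierstrassCurve

namespace Isogeny

open Literature.NumberTheory.EllipticCurves Affine.Point

variable {K : Type u} [Field K] [NumberField K] {W W' : WeierstrassCurve K}
  [W.IsElliptic] [W'.IsElliptic]

omit [W.IsElliptic] [W'.IsElliptic] in
/-- **The Cassels–Tate step of Milne's proof of *ADT* Thm. I.7.3** (p. 98): if `Ш(E)` and `Ш(E')`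
are finite and carry `ℚ/ℤ`-valued pairings `B`, `B'` with trivial (right, resp. left) kernel for
which `Ш(φ) : Ш(E) → Ш(E')` and `Ш(ψ) : Ш(E') → Ш(E)` are adjoint
(`B' (Ш(φ) a) b' = B a (Ш(ψ) b')`; for the Cassels–Tate pairings and `ψ = φ̂` this is *ADT*
I.6.13(a) with Remark I.6.10(a)), then `#coker Ш(φ) = #ker Ш(ψ)`, whence
`#Ш(E) · #ker Ш(ψ) = #Ш(E') · #ker Ш(φ)` — hypothesis (Ш) of
`Isogeny.card_sha_mul_regulator_mul_eq_of_sha_of_keyIdentity`.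
[cite: MilneADT2006, Ch. I, proof of Thm. 7.3, p. 98; Remark 6.10(a), Thm. 6.13(a)] -/
theorem card_sha_mul_card_ker_eq_of_pairing (φ : Isogeny W W') (ψ : Isogeny W' W)
    [Finite W.sha] [Finite W'.sha]
    (B : W.sha →+ W.sha →+ AddCircle (1 : ℚ)) (B' : W'.sha →+ W'.sha →+ AddCircle (1 : ℚ))
    (hB : ∀ y, (∀ x, B x y = 0) → y = 0) (hB' : ∀ x, (∀ y, B' x y = 0) → x = 0)
    (hadj : ∀ a b',
      B' (shaMap φ.toAddMonoidHom φ.equivariant φ.hasLocalPointsMaps_toAddMonoidHom a) b' =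
        B a (shaMap ψ.toAddMonoidHom ψ.equivariant ψ.hasLocalPointsMaps_toAddMonoidHom b')) :
    Nat.card W.sha *
        Nat.card (shaMap ψ.toAddMonoidHom ψ.equivariant ψ.hasLocalPointsMaps_toAddMonoidHom).ker =
      Nat.card W'.sha *
        Nat.card (shaMap φ.toAddMonoidHom φ.equivariant φ.hasLocalPointsMaps_toAddMonoidHom).ker := by
  have h := card_ker_mul_card_eq_index_range_mul_card
    (shaMap φ.toAddMonoidHom φ.equivariant φ.hasLocalPointsMaps_toAddMonoidHom)
  rw [index_range_eq_natCard_ker_of_adjoint B B' hB hB' _ _ hadj] at h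
  rw [mul_comm, ← h, mul_comm]

/-- **Milne's Theorem I.7.3 for elliptic curves over a number field, reduced to the Cassels–Tate
pairings and (7.3.1).** `Isogeny.card_sha_mul_regulator_mul_eq_of_sha_of_keyIdentity` with its
hypothesis (Ш) discharged from: alternating pairings `B`, `B'` on `Ш(E)`, `Ш(E')` with values in
`ℚ/ℤ` whose left kernels consist of divisible elements (the Cassels–Tate pairings, *ADT* Prop.
I.6.9 and Thm. I.6.13(a); the shape of `WeierstrassCurve.exists_casselsTate_pairing`) and for
which `Ш(φ)`, `Ш(ψ)` (`ψ = φ̂`, `ψ ∘ φ = [deg φ]`) are adjoint (*ADT* Remark I.6.10(a),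
`⟨f(a), b⟩ = ⟨a, fᵗ(b)⟩`, with `E ≅ Eᵗ`, `E' ≅ E'ᵗ`). Since `Ш(E)` is finite by hypothesis and
`Ш(E')` by Lemma I.7.1(b) (`Isogeny.shaFinite_iff_shaFinite`), the divisible subgroups vanish
and the pairings are nondegenerate (p. 98), so `card_sha_mul_card_ker_eq_of_pairing` applies.
What remains assumed is (7.3.1) (`h731`, *ADT* p. 98, from Tate local duality, Poitou–Tate
I.4.10 and I.5.2(a), pp. 99–100).
[cite: MilneADT2006, Ch. I, Thm. 7.3 and its proof, (7.3.1), pp. 97–100; 6.10(a); 6.13(a)] -/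
theorem card_sha_mul_regulator_mul_eq_of_casselsTate_of_keyIdentity (φ : Isogeny W W')
    (ψ : Isogeny W' W) (hψφ : ∀ P : W.geomPoints, ψ (φ P) = (φ.degree : ℤ) • P)
    (f : W.toAffine.Point →+ W'.toAffine.Point)
    (hf : ∀ P, W'.toGeomPoints (f P) = φ (W.toGeomPoints P))
    (g : W'.toAffine.Point →+ W.toAffine.Point)
    (hg : ∀ Q, W.toGeomPoints (g Q) = ψ (W'.toGeomPoints Q))
    (hCT : ∃ (B : W.sha →+ W.sha →+ AddCircle (1 : ℚ)) (B' : W'.sha →+ W'.sha →+ AddCircle (1 : ℚ)),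
      (∀ x, B x x = 0) ∧ (∀ x, (∀ y, B x y = 0) → x ∈ AddSubgroup.divisibleElements W.sha) ∧
      (∀ x, B' x x = 0) ∧ (∀ x, (∀ y, B' x y = 0) → x ∈ AddSubgroup.divisibleElements W'.sha) ∧
      ∀ a b', B' (shaMap φ.toAddMonoidHom φ.equivariant φ.hasLocalPointsMaps_toAddMonoidHom a) b' =
        B a (shaMap ψ.toAddMonoidHom ψ.equivariant ψ.hasLocalPointsMaps_toAddMonoidHom b'))
    (x x' : ℝ)
    (h731 : x *
        Nat.card (shaMap φ.toAddMonoidHom φ.equivariant φ.hasLocalPointsMaps_toAddMonoidHom).ker *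
          Nat.card g.ker * f.range.index =
      x' *
        Nat.card (shaMap ψ.toAddMonoidHom ψ.equivariant ψ.hasLocalPointsMaps_toAddMonoidHom).ker *
          Nat.card f.ker * g.range.index)
    (hfin : W.ShaFinite) :
    (Nat.card W'.sha : ℝ) * W'.regulator * x' *
        (Nat.card (AddCommGroup.torsion W.toAffine.Point) : ℝ) ^ 2 =
      (Nat.card W.sha : ℝ) * W.regulator * x *
        (Nat.card (AddCommGroup.torsion W'.toAffine.Point) : ℝ) ^ 2 := by
  haveI : Finite W.sha := hfin
  haveI : Finite W'.sha := (φ.shaFinite_iff_shaFinite).mp hfin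
  obtain ⟨B, B', hBalt, hBker, _, hB'ker, hadj⟩ := hCT
  -- finite groups have no divisible elements: both pairings are nondegenerate
  have hB' : ∀ x, (∀ y, B' x y = 0) → x = 0 := fun x hx ↦ by
    simpa [divisibleElements_eq_bot_of_finite] using hB'ker x hx
  have hB : ∀ y, (∀ x, B x y = 0) → y = 0 := fun y hy ↦ by
    have hy' : ∀ x, B y x = 0 := fun x ↦ by rw [pairing_swap_eq_neg B hBalt x y, hy x, _root_.neg_zero]
    simpa [divisibleElements_eq_bot_of_finite] using hBker y hy'
  exact card_sha_mul_regulator_mul_eq_of_sha_of_keyIdentity φ ψ hψφ f hf g hg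
    (card_sha_mul_card_ker_eq_of_pairing φ ψ B B' hB hB' hadj) x x' h731 hfin

end Isogeny

section Rat

open Literature.NumberTheory.EllipticCurves Affine.Point

variable {W W' : WeierstrassCurve ℚ}

/-- **Cassels' theorem over `ℚ` (`WeierstrassCurve.bsdRHS_eq_of_isIsogenous`) reduced to the
Cassels–Tate pairings and Milne's formula (7.3.1) with its local side evaluated.**
`WeierstrassCurve.bsdRHS_eq_of_sha_of_keyIdentity` with hypothesis (Ш) discharged from the
existence of alternating `ℚ/ℤ`-valued pairings on `Ш(E)`, `Ш(E')` with left kernels inside the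
divisible subgroups (*ADT* I.6.9, I.6.13(a); Silverman X.4.14) making `Ш(φ)`, `Ш(φ̂)` adjoint
(*ADT* I.6.10(a)). If moreover
`Ω(E) ∏c_p(E) · #ker Ш(φ) · #ker φ̂(ℚ) · [E'(ℚ) : φ(E(ℚ))] =
Ω(E') ∏c_p(E') · #ker Ш(φ̂) · #ker φ(ℚ) · [E(ℚ) : φ̂(E'(ℚ))]` ((7.3.1), *ADT* p. 98, with
`∏_{v∈S} z(φ(ℚ_v)) = Ω(E)∏c_p(E)/(Ω(E')∏c_p(E'))` for globally minimal models) and `Ш(E/ℚ)` is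
finite, then `E` and `E'` have the same Birch–Swinnerton-Dyer quotient `WeierstrassCurve.bsdRHS`.
Polymorphic in the `DecidableEq ℚ` instance of the group law.
[cite: MilneADT2006, Ch. I, Thm. 7.3 and its proof, (7.3.1), pp. 97–100; 6.10(a); 6.13(a)] -/
theorem bsdRHS_eq_of_casselsTate_of_keyIdentity [DecidableEq ℚ] [W.IsElliptic] [W'.IsElliptic]
    (φ : Isogeny W W') (ψ : Isogeny W' W)
    (hψφ : ∀ P : W.geomPoints, ψ (φ P) = (φ.degree : ℤ) • P)
    (f : W.toAffine.Point →+ W'.toAffine.Point)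
    (hf : ∀ P, W'.toGeomPoints (f P) = φ (W.toGeomPoints P))
    (g : W'.toAffine.Point →+ W.toAffine.Point)
    (hg : ∀ Q, W.toGeomPoints (g Q) = ψ (W'.toGeomPoints Q))
    (hCT : ∃ (B : W.sha →+ W.sha →+ AddCircle (1 : ℚ)) (B' : W'.sha →+ W'.sha →+ AddCircle (1 : ℚ)),
      (∀ x, B x x = 0) ∧ (∀ x, (∀ y, B x y = 0) → x ∈ AddSubgroup.divisibleElements W.sha) ∧
      (∀ x, B' x x = 0) ∧ (∀ x, (∀ y, B' x y = 0) → x ∈ AddSubgroup.divisibleElements W'.sha) ∧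
      ∀ a b', B' (shaMap φ.toAddMonoidHom φ.equivariant φ.hasLocalPointsMaps_toAddMonoidHom a) b' =
        B a (shaMap ψ.toAddMonoidHom ψ.equivariant ψ.hasLocalPointsMaps_toAddMonoidHom b'))
    (h731 : W.realPeriodRat * W.tamagawaProduct *
        Nat.card (shaMap φ.toAddMonoidHom φ.equivariant φ.hasLocalPointsMaps_toAddMonoidHom).ker *
          Nat.card g.ker * f.range.index =
      W'.realPeriodRat * W'.tamagawaProduct *
        Nat.card (shaMap ψ.toAddMonoidHom ψ.equivariant ψ.hasLocalPointsMaps_toAddMonoidHom).ker *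
          Nat.card f.ker * g.range.index)
    (hfin : W.ShaFinite) : W'.bsdRHS = W.bsdRHS := by
  haveI : Finite W.sha := hfin
  haveI : Finite W'.sha := (φ.shaFinite_iff_shaFinite).mp hfin
  obtain ⟨B, B', hBalt, hBker, _, hB'ker, hadj⟩ := hCT
  have hB' : ∀ x, (∀ y, B' x y = 0) → x = 0 := fun x hx ↦ by
    simpa [divisibleElements_eq_bot_of_finite] using hB'ker x hx
  have hB : ∀ y, (∀ x, B x y = 0) → y = 0 := fun y hy ↦ by
    have hy' : ∀ x, B y x = 0 := fun x ↦ by rw [pairing_swap_eq_neg B hBalt x y, hy x, _root_.neg_zero]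
    simpa [divisibleElements_eq_bot_of_finite] using hBker y hy'
  exact bsdRHS_eq_of_sha_of_keyIdentity φ ψ hψφ f hf g hg
    (Isogeny.card_sha_mul_card_ker_eq_of_pairing φ ψ B B' hB hB' hadj) h731 hfin

/-- **Cassels' theorem assembled: the named fact `WeierstrassCurve.bsdRHS_eq_of_isIsogenous`
(Milne, *ADT*, Thm. I.7.3 with Rmk. 7.4, in quotient form) from the two remaining inputs of
Milne's proof**, each quantified over all `ℚ`-isogenies of elliptic curves `φ : E → E'` with dual
`ψ = φ̂` normalised by `ψ ∘ φ = [deg φ]` (`Isogeny.exists_dual_of_isElliptic`):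
(CT) Cassels–Tate pairings on `Ш(E)`, `Ш(E')` with values in `ℚ/ℤ`, alternating, with left
kernels inside the divisible subgroups (*ADT* I.6.9, I.6.13(a); Silverman X.4.14, the shape of
`WeierstrassCurve.exists_casselsTate_pairing`) and making `Ш(φ)`, `Ш(ψ)` adjoint (*ADT* I.6.10(a));
(7.3.1) for globally minimal models, Milne's formula (7.3.1) (p. 98) with its local side
`∏_{v ∈ S} z(φ(ℚ_v)) = Ω(E)∏c_p(E) / (Ω(E')∏c_p(E'))` (pp. 98–99) evaluated:
`Ω(E) ∏c_p(E) · #ker Ш(φ) · #ker ψ(ℚ) · [E'(ℚ) : φ(E(ℚ))] =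
Ω(E') ∏c_p(E') · #ker Ш(ψ) · #ker φ(ℚ) · [E(ℚ) : ψ(E'(ℚ))]`, for any homomorphisms of rational
points `f = φ(ℚ)`, `g = ψ(ℚ)` (`Isogeny.exists_pointHom`; polymorphic in the `DecidableEq ℚ`
instance of the group law).
The assembly picks `φ`, `ψ`, `f`, `g`, gets the finiteness of `Ш(E'/ℚ)` from Lemma I.7.1(b)
(`Isogeny.shaFinite_iff_shaFinite`) and applies `bsdRHS_eq_of_casselsTate_of_keyIdentity`
(bookkeeping of Lemma 7.2, the height adjunction `Isogeny.heightPairing_pointHom_left`, and the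
`ℚ/ℤ`-duality step of p. 98); the discharge `bsdRHS_eq_of_isIsogenous_holds` is this theorem
applied to proofs of (CT) and (7.3.1) — Tate local duality (I.3.4, 3.7), Poitou–Tate (I.4.10),
the Euler characteristic formula (I.5.2(a)), global class field theory and the local volume
computations, none of which is in Mathlib or the tree.
[cite: MilneADT2006, Ch. I, Thm. 7.3, Rmk. 7.4 and the proof of 7.3, (7.3.1), pp. 97–100] -/
theorem bsdRHS_eq_of_isIsogenous_of_casselsTate_of_keyIdentity
    (hCT : ∀ (W W' : WeierstrassCurve ℚ) [W.IsElliptic] [W'.IsElliptic] (φ : Isogeny W W')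
      (ψ : Isogeny W' W), (∀ P : W.geomPoints, ψ (φ P) = (φ.degree : ℤ) • P) →
      ∃ (B : W.sha →+ W.sha →+ AddCircle (1 : ℚ)) (B' : W'.sha →+ W'.sha →+ AddCircle (1 : ℚ)),
        (∀ x, B x x = 0) ∧ (∀ x, (∀ y, B x y = 0) → x ∈ AddSubgroup.divisibleElements W.sha) ∧
        (∀ x, B' x x = 0) ∧ (∀ x, (∀ y, B' x y = 0) → x ∈ AddSubgroup.divisibleElements W'.sha) ∧
        ∀ a b', B' (shaMap φ.toAddMonoidHom φ.equivariant φ.hasLocalPointsMaps_toAddMonoidHom a) b' =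
          B a (shaMap ψ.toAddMonoidHom ψ.equivariant ψ.hasLocalPointsMaps_toAddMonoidHom b'))
    (h731 : ∀ (W W' : WeierstrassCurve ℚ) [DecidableEq ℚ] [W.IsElliptic] [W'.IsElliptic]
      [W.IsGloballyMinimal] [W'.IsGloballyMinimal] (φ : Isogeny W W') (ψ : Isogeny W' W),
      (∀ P : W.geomPoints, ψ (φ P) = (φ.degree : ℤ) • P) →
      ∀ (f : W.toAffine.Point →+ W'.toAffine.Point),
        (∀ P, W'.toGeomPoints (f P) = φ (W.toGeomPoints P)) →
      ∀ (g : W'.toAffine.Point →+ W.toAffine.Point),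
        (∀ Q, W.toGeomPoints (g Q) = ψ (W'.toGeomPoints Q)) →
      W.realPeriodRat * W.tamagawaProduct *
          Nat.card (shaMap φ.toAddMonoidHom φ.equivariant φ.hasLocalPointsMaps_toAddMonoidHom).ker *
            Nat.card g.ker * f.range.index =
        W'.realPeriodRat * W'.tamagawaProduct *
          Nat.card (shaMap ψ.toAddMonoidHom ψ.equivariant ψ.hasLocalPointsMaps_toAddMonoidHom).ker *
            Nat.card f.ker * g.range.index) :
    bsdRHS_eq_of_isIsogenous := by
  intro W W' _ _ _ _ hiso hfin
  obtain ⟨φ⟩ := hiso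
  refine ⟨φ.shaFinite_iff_shaFinite.mp hfin, ?_⟩
  obtain ⟨ψ, hψφ⟩ := φ.exists_dual_of_isElliptic
  obtain ⟨f, hf⟩ := φ.exists_pointHom
  obtain ⟨g, hg⟩ := ψ.exists_pointHom
  exact @bsdRHS_eq_of_casselsTate_of_keyIdentity W W' (fun a b ↦ Classical.propDecidable (a = b))
    _ _ φ ψ hψφ f hf g hg (hCT W W' φ ψ hψφ)
    (@h731 W W' (fun a b ↦ Classical.propDecidable (a = b)) _ _ _ _ φ ψ hψφ f hf g hg) hfin

end Rat

end WeierstrassCurve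

end
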